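import Mathlib
import HarnessLib
import Summits.PneNP.PneNP.Theorems.AeaCutRectanglesTransversalEngine
import Summits.PneNP.PneNP.Theorems.AeaCutRectanglesDutyRectangles
import Summits.PneNP.PneNP.Theorems.AeaCutRectanglesClassCuts

/-!
# Crux FoolingMeasure (stmt-PneNP-19727) — p4 g4 typed kill-side statements for the unit engine

Companion to `Cruxes/FoolingMeasure/BarrierNotesP4g4.md` (§1, §3, §6).  Everything here concerns the HYPOTHESIS of
`AeaCutRectanglesFixedCutFooling.foolingMeasure_of_spreadSystem` (frame `W`, units `π i` of two loopless pairs,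
D1 cover over transversals, D2 witnesses, SPREAD over near-balanced cuts), never `FoolingMeasure` itself.

* `NoSpread`      — "the engine cannot fire": every D1 ∧ D2 unit system has, for every window width, a near-balanced cut
                    splitting fewer than `(n/2)·log₂ n + C·n` units.  The honest engine-level kill target.
* `ZeroBisection` — the sharp form suggested by every exhibited system and certified by census for `n ≤ 8`
                    (BarrierNotesP4g4 §5B): some cut with `⌊n/2⌋ ≤ |B| ≤ ⌈n/2⌉` splits NO unit.
* `zeroBisection_noSpread` — the sharp form implies the kill target (stub).
* `splitUnits_eq_empty_of_parallel_classes` — (F1) parallel-class kill (PROVED here, sorry-free).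
* `card_splitUnits_le_of_intersecting_cells` — (F4) k-witness intersecting-cell bound, generalising
  `AeaCutRectanglesClassCuts.card_splitUnits_le_one_of_subset_class` (PROVED here, sorry-free).
* `wmax`, `unit_mono_of_witness`, `subset_wmax`, `isUnitSystem_wmax`, `agree_of_not_mem_wmax`, `exists_witnesses` —
  (F6) WITNESS-CODE NORMAL FORM: WLOG the frame is the maximal one compatible with the D2 witnesses (PROVED, sorry-free);
  this is the soundness-and-completeness lemma behind the symmetry reduction `JOB_WMAX=1` of census v4 (BarrierNotesP4g4 §5B/§6).
* `transversal_pair_critical` — (F3, formal half) every transversal pair is colour-critical in its transversal graph.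

Everything is sorry-free (planner workfile; the statements are the deliverable).  HONEST FRAMING: elementary
finite combinatorics about proper 3-colourings; FRONTIER material; nothing here bears on P vs NP.
-/

set_option linter.dupNamespace false

namespace Summit.PneNP.PneNP.Cruxes.FoolingMeasure.P4g4

open Finset
open Summit.PneNP.PneNP.Theorems.AeaCutRectanglesTransversalEngine
open Summit.PneNP.PneNP.Theorems.AeaCutRectanglesDutyRectangles
open Summit.PneNP.PneNP.Theorems.AeaCutRectanglesClassCuts

/-- A D1 ∧ D2 UNIT SYSTEM on `Fin n` with `m` units (the first three conjuncts of the engine hypothesis). -/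
def IsUnitSystem (n m : ℕ) (W : Finset (Sym2 (Fin n))) (π : Fin m → Finset (Sym2 (Fin n))) : Prop :=
  (∀ i, (π i).card = 2) ∧
  (∀ t : Fin m → Sym2 (Fin n), (∀ i, t i ∈ π i) →
    (∀ e ∈ tg W t, ¬ e.IsDiag) ∧ ¬ (SimpleGraph.fromEdgeSet (↑(tg W t) : Set (Sym2 (Fin n)))).Colorable 3) ∧
  (∀ i, (SimpleGraph.fromEdgeSet (↑(gammaMinus W π i) : Set (Sym2 (Fin n)))).Colorable 3)

/-- **NoSpread** — the engine-level kill target: for every window half-width `ε > 0` there is `C` such that, for all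
large `n`, EVERY D1 ∧ D2 unit system on `Fin n` has a near-balanced cut splitting fewer than `(n/2)·log₂ n + C·n`
units.  (`NoSpread` makes the hypothesis of `foolingMeasure_of_spreadSystem` unsatisfiable; it says nothing about
`FoolingMeasure`.) -/
def NoSpread : Prop :=
  ∀ ε : ℝ, 0 < ε → ∃ C : ℕ, ∀ᶠ n in Filter.atTop, ∀ (m : ℕ) (W : Finset (Sym2 (Fin n)))
    (π : Fin m → Finset (Sym2 (Fin n))), IsUnitSystem n m W π →
      ∃ B : Finset (Fin n), (1 / 2 - ε) * (n : ℝ) ≤ B.card ∧ (B.card : ℝ) ≤ (1 / 2 + ε) * n ∧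
        ((splitUnits π B).card : ℝ) < (n : ℝ) / 2 * Real.logb 2 n + (C : ℝ) * n

/-- **ZeroBisection** — the sharp conjectural form (census-certified for `n ≤ 8`, true for every exhibited system):
every D1 ∧ D2 unit system has a (near-)bisection that splits NO unit. -/
def ZeroBisection : Prop :=
  ∀ (n m : ℕ) (W : Finset (Sym2 (Fin n))) (π : Fin m → Finset (Sym2 (Fin n))), IsUnitSystem n m W π →
    ∃ B : Finset (Fin n), n / 2 ≤ B.card ∧ B.card ≤ (n + 1) / 2 ∧ splitUnits π B = ∅

/-- The sharp form implies the kill target (a bisection lies in every window once `n ≥ 1/ε`; zero is below the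
spread demand). -/
theorem zeroBisection_noSpread : ZeroBisection → NoSpread := by
  intro hZ ε hε
  refine ⟨0, ?_⟩
  obtain ⟨N, hN⟩ := exists_nat_gt (1 / (2 * ε))
  refine Filter.eventually_atTop.2 ⟨max N 2, fun n hn m W π hsys => ?_⟩
  obtain ⟨B, hB1, hB2, hB0⟩ := hZ n m W π hsys
  have hn2 : 2 ≤ n := le_of_max_le_right hn
  have hnN : N ≤ n := le_of_max_le_left hn
  have hεn : 1 / 2 ≤ ε * n := by
    have h1 : 1 / (2 * ε) < n := hN.trans_le (by exact_mod_cast hnN)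
    have h2 : 1 / (2 * ε) * (2 * ε) = 1 := by field_simp
    nlinarith [h1, h2, hε]
  have hlo : ((n : ℝ) - 1) / 2 ≤ (B.card : ℝ) := by
    have h : n ≤ 2 * (n / 2) + 1 := by omega
    have h' : (n : ℝ) ≤ 2 * ((n / 2 : ℕ) : ℝ) + 1 := by exact_mod_cast h
    have h'' : ((n / 2 : ℕ) : ℝ) ≤ B.card := by exact_mod_cast hB1
    linarith
  have hhi : (B.card : ℝ) ≤ ((n : ℝ) + 1) / 2 := by
    have h : 2 * ((n + 1) / 2) ≤ n + 1 := Nat.mul_div_le (n + 1) 2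
    have h' : 2 * (((n + 1) / 2 : ℕ) : ℝ) ≤ (n : ℝ) + 1 := by exact_mod_cast h
    have h'' : (B.card : ℝ) ≤ (((n + 1) / 2 : ℕ) : ℝ) := by exact_mod_cast hB2
    linarith
  refine ⟨B, by linarith, by linarith, ?_⟩
  rw [hB0, Finset.card_empty, Nat.cast_zero, zero_mul, add_zero]
  have hlog : 1 ≤ Real.logb 2 n := by
    rw [← Real.logb_self_eq_one (by norm_num : (1 : ℝ) < 2)]
    exact Real.logb_le_logb_of_le (by norm_num) (by norm_num) (by exact_mod_cast hn2)
  have hnpos : (0 : ℝ) < n := by exact_mod_cast (lt_of_lt_of_le (by norm_num) hn2)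
  positivity

/-- **(F1) Parallel-class kill.**  If the classes of `cls` have size `≤ 2εn` and both pairs of every unit meet the same
multiset of classes, some union of classes is a near-balanced cut splitting no unit (so every copy / lift / blow-up
design, and W1's twin frames, fail SPREAD irrespective of the number of units). -/
theorem splitUnits_eq_empty_of_parallel_classes {n m k : ℕ} (ε : ℝ) (hε : 0 < ε)
    (π : Fin m → Finset (Sym2 (Fin n))) (cls : Fin n → Fin k)
    (hsmall : ∀ a : Fin k, ((univ.filter fun v => cls v = a).card : ℝ) ≤ 2 * ε * n)
    (hpar : ∀ i, ∀ e ∈ π i, ∀ e' ∈ π i, e.map cls = e'.map cls) :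
    ∃ A : Finset (Fin k),
      (1 / 2 - ε) * (n : ℝ) ≤ (univ.filter fun v => cls v ∈ A).card ∧
      ((univ.filter fun v => cls v ∈ A).card : ℝ) ≤ (1 / 2 + ε) * n ∧
      splitUnits π (univ.filter fun v => cls v ∈ A) = ∅ := by
  classical
  -- prefix unions of classes, in the order of `Fin k`
  set f : ℕ → ℕ := fun j => (univ.filter fun v : Fin n => (cls v : ℕ) < j).card with hf
  have hf0 : f 0 = 0 := by simp [hf]
  have hfk : f k = n := by
    have h : (univ.filter fun v : Fin n => (cls v : ℕ) < k) = univ :=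
      filter_true_of_mem fun v _ => (cls v).is_lt
    simp only [hf]
    rw [h, card_univ, Fintype.card_fin]
  have hstep : ∀ j, (f (j + 1) : ℝ) ≤ f j + 2 * ε * n := by
    intro j
    have hsplit : (univ.filter fun v : Fin n => (cls v : ℕ) < j + 1) =
        (univ.filter fun v : Fin n => (cls v : ℕ) < j) ∪ (univ.filter fun v : Fin n => (cls v : ℕ) = j) := by
      ext v
      simp only [mem_filter, mem_union, mem_univ, true_and]
      omega
    have hdisj : Disjoint (univ.filter fun v : Fin n => (cls v : ℕ) < j)
        (univ.filter fun v : Fin n => (cls v : ℕ) = j) := by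
      rw [disjoint_filter]
      intro v _ h1 h2
      omega
    have hcls : (((univ.filter fun v : Fin n => (cls v : ℕ) = j)).card : ℝ) ≤ 2 * ε * n := by
      by_cases hj : j < k
      · have h : (univ.filter fun v : Fin n => (cls v : ℕ) = j) = (univ.filter fun v => cls v = ⟨j, hj⟩) := by
          ext v
          simp [Fin.ext_iff]
        rw [h]
        exact hsmall ⟨j, hj⟩
      · have h : (univ.filter fun v : Fin n => (cls v : ℕ) = j) = ∅ := by
          ext v
          simp only [mem_filter, mem_univ, true_and, Finset.notMem_empty, iff_false]
          intro h
          exact hj (h ▸ (cls v).is_lt)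
        rw [h, card_empty, Nat.cast_zero]
        positivity
    have h1 : (f (j + 1) : ℝ) = f j + ((univ.filter fun v : Fin n => (cls v : ℕ) = j).card : ℝ) := by
      simp only [hf]
      rw [hsplit, card_union_of_disjoint hdisj, Nat.cast_add]
    linarith
  -- the first prefix union reaching the window's lower end lands inside the window
  have hex : ∃ j, (1 / 2 - ε) * (n : ℝ) ≤ f j :=
    ⟨k, by rw [hfk]; nlinarith [hε, (Nat.cast_nonneg n : (0 : ℝ) ≤ n)]⟩
  obtain ⟨j₀, hP, hmin⟩ : ∃ j₀, (1 / 2 - ε) * (n : ℝ) ≤ f j₀ ∧ ∀ j < j₀, ¬ (1 / 2 - ε) * (n : ℝ) ≤ f j :=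
    ⟨Nat.find hex, Nat.find_spec hex, fun j hj => Nat.find_min hex hj⟩
  have hup : (f j₀ : ℝ) ≤ (1 / 2 + ε) * n := by
    rcases Nat.eq_zero_or_pos j₀ with h0 | hpos
    · rw [h0, hf0, Nat.cast_zero]
      positivity
    · have hlt := hmin (j₀ - 1) (by omega)
      push Not at hlt
      have h := hstep (j₀ - 1)
      rw [Nat.sub_add_cancel hpos] at h
      linarith
  refine ⟨univ.filter fun a : Fin k => (a : ℕ) < j₀, ?_⟩
  have hB : (univ.filter fun v : Fin n => cls v ∈ univ.filter fun a : Fin k => (a : ℕ) < j₀) =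
      (univ.filter fun v : Fin n => (cls v : ℕ) < j₀) := by
    ext v
    simp
  rw [hB]
  refine ⟨hP, hup, ?_⟩
  -- zero split: `[e ⊆ B]` depends only on `e.map cls`, which is the same for both pairs of a unit
  ext i
  simp only [Finset.notMem_empty, iff_false]
  intro hi
  obtain ⟨⟨e, he, hin⟩, ⟨e', he', v, hv, hvout⟩⟩ := mem_splitUnits.1 hi
  apply hvout
  have hmem : cls v ∈ e.map cls := by
    rw [hpar i e he e' he']
    exact Sym2.mem_map.2 ⟨v, hv, rfl⟩
  obtain ⟨u, hu, huv⟩ := Sym2.mem_map.1 hmem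
  have hu' := hin u hu
  simp only [mem_filter, mem_univ, true_and] at hu' ⊢
  rw [huv] at hu'
  exact hu'

/-- **(F4) Intersecting-cell cuts.**  `k` D2 witnesses `c j` (proper on `Γ − π (idx j)`), loopless units, a family `𝓕`
of cells of the overlay partition any two of which agree in some coordinate, and a cut `B` inside the union of those
cells: then only the witnessed units can be split, so `s(B) ≤ k`.  (`k = 1`, `𝓕 = {γ}` is
`card_splitUnits_le_one_of_subset_class`.) -/
theorem card_splitUnits_le_of_intersecting_cells {V ι : Type*} [Fintype V] [DecidableEq V] [Fintype ι]
    [DecidableEq ι] {k : ℕ} {W : Finset (Sym2 V)} {π : ι → Finset (Sym2 V)} (idx : Fin k → ι)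
    (c : Fin k → V → Fin 3) (hc : ∀ j, c j ∉ killSet (gammaMinus W π (idx j)))
    (hloop : ∀ i, ∀ e ∈ π i, ¬ e.IsDiag) (𝓕 : Finset (Fin k → Fin 3))
    (h𝓕 : ∀ f ∈ 𝓕, ∀ g ∈ 𝓕, ∃ j, f j = g j) (B : Finset V) (hB : ∀ v ∈ B, (fun j => c j v) ∈ 𝓕) :
    (splitUnits π B).card ≤ k := by
  classical
  have hsub : splitUnits π B ⊆ univ.image idx := by
    intro i hi
    obtain ⟨⟨e, he, hin⟩, -⟩ := mem_splitUnits.1 hi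
    by_contra hni
    have hne : ∀ j, idx j ≠ i := fun j h => hni (mem_image.2 ⟨j, mem_univ _, h⟩)
    induction e using Sym2.ind with
    | h a b =>
      have ha : a ∈ B := hin a (Sym2.mem_mk_left a b)
      have hb : b ∈ B := hin b (Sym2.mem_mk_right a b)
      obtain ⟨j, hj⟩ := h𝓕 _ (hB a ha) _ (hB b hb)
      exact hc j ⟨s(a, b), mem_gammaMinus.2 (Or.inr ⟨i, (hne j).symm, he⟩), hloop i _ he, by
        rw [Sym2.map_mk, Sym2.mk_isDiag_iff]; simpa using hj⟩
  calc (splitUnits π B).card ≤ (univ.image idx).card := card_le_card hsub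
    _ ≤ (univ : Finset (Fin k)).card := card_image_le
    _ = k := by simp


/-! ### (F6) Witness-code normal form: WLOG the frame is maximal

Given D2 witnesses `c i` (proper colourings of `Γ − πᵢ`), every loopless pair that is bichromatic under EVERY witness
and lies in no unit can be ADDED to the frame: D2 is preserved (each `c i` stays proper) and D1 can only get easier
(fewer colourings to cover).  Units — hence `splitUnits`, `α(D)`, `m` — are unchanged, so for every existence question
about unit systems one may assume `W = wmax c π`.  Equivalently a unit system IS a WITNESS CODE: `m` maps
`c i : Fin n → Fin 3` with designated private pairs (monochromatic under `c i` only), subject to the cover condition over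
partitions of `Fin n` into three cliques of the agreement graph.  (BarrierNotesP4g4 §6; census v4 `JOB_WMAX=1`.) -/

/-- The maximal frame compatible with witnesses `c` and units `π`: all loopless pairs bichromatic under every `c i`
and lying in no unit. -/
def wmax {n m : ℕ} (c : Fin m → Fin n → Fin 3) (π : Fin m → Finset (Sym2 (Fin n))) : Finset (Sym2 (Fin n)) :=
  univ.filter fun e => ¬ e.IsDiag ∧ (∀ i, ¬ (e.map (c i)).IsDiag) ∧ ∀ i, e ∉ π i

theorem mem_wmax {n m : ℕ} {c : Fin m → Fin n → Fin 3} {π : Fin m → Finset (Sym2 (Fin n))} {e : Sym2 (Fin n)} :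
    e ∈ wmax c π ↔ ¬ e.IsDiag ∧ (∀ i, ¬ (e.map (c i)).IsDiag) ∧ ∀ i, e ∉ π i := by
  simp [wmax]

/-- In a D1 ∧ D2 system every D2 witness of unit `i` makes BOTH pairs of unit `i` monochromatic (cover applied to the
witness along a transversal through the given pair). -/
theorem unit_mono_of_witness {n m : ℕ} {W : Finset (Sym2 (Fin n))} {π : Fin m → Finset (Sym2 (Fin n))}
    (hsys : IsUnitSystem n m W π) {i : Fin m} {c : Fin n → Fin 3} (hc : c ∉ killSet (gammaMinus W π i))
    {e : Sym2 (Fin n)} (he : e ∈ π i) : (e.map c).IsDiag := by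
  obtain ⟨hcard, hD1, -⟩ := hsys
  -- a transversal through `e`
  have hne : ∀ j, (π j).Nonempty := fun j => card_pos.1 (by rw [hcard j]; norm_num)
  classical
  let t : Fin m → Sym2 (Fin n) := fun j => if j = i then e else (hne j).choose
  have ht : ∀ j, t j ∈ π j := by
    intro j
    by_cases hj : j = i
    · subst hj; simp [t, he]
    · simp [t, hj, (hne j).choose_spec]
  obtain ⟨hloop, hnc⟩ := hD1 t ht
  have hkill : c ∈ killSet (tg W t) := (not_colorable_iff_forall_mem_killSet _).1 hnc c
  obtain ⟨e', he', hd', hm'⟩ := hkill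
  rcases mem_tg.1 he' with hW | ⟨j, rfl⟩
  · exact absurd ⟨e', mem_gammaMinus.2 (Or.inl hW), hd', hm'⟩ hc
  · by_cases hj : j = i
    · subst hj; simpa [t] using hm'
    · exact absurd ⟨t j, mem_gammaMinus.2 (Or.inr ⟨j, hj, ht j⟩), hd', hm'⟩ hc

/-- The original frame lies inside the maximal one. -/
theorem subset_wmax {n m : ℕ} {W : Finset (Sym2 (Fin n))} {π : Fin m → Finset (Sym2 (Fin n))}
    (hsys : IsUnitSystem n m W π) {c : Fin m → Fin n → Fin 3} (hc : ∀ i, c i ∉ killSet (gammaMinus W π i)) :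
    W ⊆ wmax c π := by
  intro e heW
  have hcard := hsys.1
  have hne : ∀ j, (π j).Nonempty := fun j => card_pos.1 (by rw [hcard j]; norm_num)
  -- `W` is loopless: it lies in every transversal graph
  have hloop : ¬ e.IsDiag := by
    obtain ⟨hl, -⟩ := hsys.2.1 (fun j => (hne j).choose) (fun j => (hne j).choose_spec)
    exact hl e (mem_tg.2 (Or.inl heW))
  refine mem_wmax.2 ⟨hloop, fun i hm => hc i ⟨e, mem_gammaMinus.2 (Or.inl heW), hloop, hm⟩, fun i hei => ?_⟩
  exact hc i ⟨e, mem_gammaMinus.2 (Or.inl heW), hloop, unit_mono_of_witness hsys (hc i) hei⟩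

/-- **(F6) Normal form.**  Replacing the frame by `wmax c π` keeps a D1 ∧ D2 unit system a D1 ∧ D2 unit system, with the
SAME witnesses (and the same units, hence the same `splitUnits π B` for every cut `B`). -/
theorem isUnitSystem_wmax {n m : ℕ} {W : Finset (Sym2 (Fin n))} {π : Fin m → Finset (Sym2 (Fin n))}
    (hsys : IsUnitSystem n m W π) {c : Fin m → Fin n → Fin 3} (hc : ∀ i, c i ∉ killSet (gammaMinus W π i)) :
    IsUnitSystem n m (wmax c π) π ∧ ∀ i, c i ∉ killSet (gammaMinus (wmax c π) π i) := by
  have hsub := subset_wmax hsys hc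
  obtain ⟨hcard, hD1, hD2⟩ := id hsys
  refine ⟨⟨hcard, fun t ht => ?_, fun i => ?_⟩, fun i => ?_⟩
  · obtain ⟨hloop, hnc⟩ := hD1 t ht
    refine ⟨fun e he => ?_, fun hcol => hnc ?_⟩
    · rcases mem_tg.1 he with hw | ⟨j, rfl⟩
      · exact (mem_wmax.1 hw).1
      · exact hloop _ (mem_tg.2 (Or.inr ⟨j, rfl⟩))
    · refine hcol.mono_left (SimpleGraph.fromEdgeSet_mono ?_)
      intro e he
      rcases mem_tg.1 (mem_coe.1 he) with hw | ⟨j, rfl⟩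
      · exact mem_coe.2 (mem_tg.2 (Or.inl (hsub hw)))
      · exact mem_coe.2 (mem_tg.2 (Or.inr ⟨j, rfl⟩))
  · exact (colorable_iff_exists_not_mem_killSet _).2 ⟨c i, fun hk => by
      obtain ⟨e, he, hd, hm⟩ := hk
      rcases mem_gammaMinus.1 he with hw | ⟨j, hj, hej⟩
      · exact (mem_wmax.1 hw).2.1 i hm
      · exact hc i ⟨e, mem_gammaMinus.2 (Or.inr ⟨j, hj, hej⟩), hd, hm⟩⟩
  · rintro ⟨e, he, hd, hm⟩
    rcases mem_gammaMinus.1 he with hw | ⟨j, hj, hej⟩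
    · exact (mem_wmax.1 hw).2.1 i hm
    · exact hc i ⟨e, mem_gammaMinus.2 (Or.inr ⟨j, hj, hej⟩), hd, hm⟩

/-- Maximality: outside `wmax c π`, every loopless non-unit pair is an AGREEMENT pair of some witness.  (So the
colourings the cover condition must handle are exactly the partitions of `Fin n` into three cliques of the agreement
graph.) -/
theorem agree_of_not_mem_wmax {n m : ℕ} {c : Fin m → Fin n → Fin 3} {π : Fin m → Finset (Sym2 (Fin n))}
    {e : Sym2 (Fin n)} (he : e ∉ wmax c π) (hd : ¬ e.IsDiag) (hu : ∀ i, e ∉ π i) :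
    ∃ i, (e.map (c i)).IsDiag := by
  by_contra h
  exact he (mem_wmax.2 ⟨hd, fun i hi => h ⟨i, hi⟩, hu⟩)

/-- D2 witnesses exist for a unit system (choice), so the normal form is always available. -/
theorem exists_witnesses {n m : ℕ} {W : Finset (Sym2 (Fin n))} {π : Fin m → Finset (Sym2 (Fin n))}
    (hsys : IsUnitSystem n m W π) : ∃ c : Fin m → Fin n → Fin 3, ∀ i, c i ∉ killSet (gammaMinus W π i) := by
  have h := fun i => (colorable_iff_exists_not_mem_killSet _).1 (hsys.2.2 i)
  exact ⟨fun i => (h i).choose, fun i => (h i).choose_spec⟩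


/-! ### (F3, formal half) Every co-transversal pair is critical

In a D1 ∧ D2 system, deleting ANY ONE unit pair from a transversal graph `W ∪ t` makes it 3-colourable (the rest
lies inside `Γ − πᵢ`), while `W ∪ t` itself is not: every pair of every transversal is a COLOUR-CRITICAL edge of its
transversal graph.  Hence each `W ∪ t` contains a 4-critical subgraph through all `m` transversal pairs (BarrierNotesP4g4
§2; the 4-critical-subgraph half is not formalised here). -/

theorem tg_erase_subset_gammaMinus {n m : ℕ} (W : Finset (Sym2 (Fin n))) (π : Fin m → Finset (Sym2 (Fin n)))
    {t : Fin m → Sym2 (Fin n)} (ht : ∀ j, t j ∈ π j) (i : Fin m) :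
    (tg W t).erase (t i) ⊆ gammaMinus W π i := by
  intro e he
  obtain ⟨hne, he'⟩ := mem_erase.1 he
  rcases mem_tg.1 he' with hW | ⟨j, rfl⟩
  · exact mem_gammaMinus.2 (Or.inl hW)
  · refine mem_gammaMinus.2 (Or.inr ⟨j, ?_, ht j⟩)
    rintro rfl
    exact hne rfl

/-- **(F3) criticality.**  Every transversal pair is critical in its transversal graph. -/
theorem transversal_pair_critical {n m : ℕ} {W : Finset (Sym2 (Fin n))} {π : Fin m → Finset (Sym2 (Fin n))}
    (hsys : IsUnitSystem n m W π) {t : Fin m → Sym2 (Fin n)} (ht : ∀ j, t j ∈ π j) (i : Fin m) :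
    ¬ (SimpleGraph.fromEdgeSet (↑(tg W t) : Set (Sym2 (Fin n)))).Colorable 3 ∧
      (SimpleGraph.fromEdgeSet (↑((tg W t).erase (t i)) : Set (Sym2 (Fin n)))).Colorable 3 := by
  refine ⟨(hsys.2.1 t ht).2, ?_⟩
  refine (hsys.2.2 i).mono_left (SimpleGraph.fromEdgeSet_mono ?_)
  intro e he
  exact mem_coe.2 (tg_erase_subset_gammaMinus W π ht i (mem_coe.1 he))

end Summit.PneNP.PneNP.Cruxes.FoolingMeasure.P4g4
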